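import Summits.BirchSwinnertonDyer.BirchSwinnertonDyer.Theorems.TwoAdicConverseOrdLambdaHalfAtTwoBDPTwoVariableDefs
import HarnessLib

/-!
# Line `kato-determinant-greenberg-two` (crux `OrdLambdaHalfAtTwo`, stmt-BirchSwinnertonDyer-19556) — the PRE-DECLARED
# `λ`-blind fallback O2♭ / O1♯ of the registered research stubs O2 / O1 (lead g7; triage r1-1 GEN 38 sharpen g38-1)

Crux workfile (sketch; `sorry`-free; nothing here is a Theorems/Literature declaration).  Written by the LEAD so that a
future hit of the integrality falsifier **F-O2-int** (triage r1-1 GEN 38, `W38.lean` `o2_forces_integral_values`: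
O2 as typed pins `G ∈ 𝒪_{ℂ₂}⟦T₁,T₂⟧` and therefore asserts the `2`-INTEGRALITY of every prescribed Greenberg value
`h_K · y · ι⁻¹(typeTwoInterpolationValueL 2 N v v̄ α ξ (−(n+1)) (m+1) ⟨θ,θ⟩ L(1))`, a genuine normalisation claim at
`2` with explicit archimedean `2`-content `2^{−(m+n+4)−s₂(m)−s₂(m+1)} < 1`) books as «stub-misstated ⇒ RESTATE item
24728 := O2♭, item 24727 := O1♯», NOT as a kill of the line: the crux is a `λ`-statement and `λ` is blind to powers
of `2`, which O1's transfer absorbs in the comparison `𝓛^PR|_cyc ∼ L₂(E)·L₂(E^K)`.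

* §1 `GreenbergLowerInclusionRatAt W K` — O2♭ at a datum: VERBATIM `GreenbergLowerInclusionAt W K` (Defs p722332 §1)
  except that `G` is pinned only UP TO A POWER OF `2` — the prescribed values are scaled by `2^a` (rendered through the
  free class-number slot of `YanZhu2026.IsGreenbergLFunctionFree₂`: `2^a · h_K` instead of `h_K`, so NO new frame
  predicate is needed) — and the lower inclusion holds with a `2`-power slack, `2^b · ch_{Λ_K}(X_Gr)·Λ_K^ur ⊆ (G)`
  (= the inclusion in `Λ_K^ur ⊗ ℚ₂`, Yan–Zhu's `S⁻¹`-currency of Thm. 4.7 (1) with `S = {2ⁿ}`).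
* §2 O2♭ `BDPSelmerLowerDivisibilityAtTwoRat`, O1♯ `SplitTwoExplicitReciprocityLawBDPRat` (O1 with the WEAKER
  hypothesis O2♭-body, hence a STRONGER bridge: the transfer must swallow the constants — harmless for its
  `λ`-conclusion `ThetaDivisibilityAt W K`).
* §3 kernel links: `O2 → O2♭` (`a = b = 0`), `O1♯ → O1`, and the fallback seam `O1♯ → O2♭ → 6‴`
  (`thetaShapiroGreenbergDivisibilityAtTwo_of_bdpRat`) — so re-registering the skeleton with {O2♭, O1♯} in place of
  {O2, O1} keeps `OrdLambdaHalfAtTwo_of` unchanged.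

HONEST FRAMING: nothing is proved about any curve; O2♭ is research-grade and NOT in print at `p = 2` exactly like O2
(every printed Greenberg-side lower inclusion needs `p` odd); this file only fixes the TEXT of the repair in advance.
BSD is not proved by any of this; `OrdLambdaHalfAtTwo` stays OPEN.

References: Yan–Zhu arXiv:2412.20078v4 Def. 3.11, Thm. 4.2 (2), Thm. 4.7 (1) [YanZhu2024MainConjNonCM];
Burungale–Castella–Skinner arXiv:2405.00270v2 Conj. 4.1.2, Thm. 4.1.3 [BurungaleCastellaSkinner2025]; cell records:
triage `Cruxes/OrdLambdaHalfAtTwo/TRIAGE-r1-1.md` GEN 38 (Δ38-3, evidence #51 `W38.lean`), Defs p722332, Lines v4.12.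
-/

set_option linter.dupNamespace false
set_option autoImplicit false

noncomputable section

open scoped Classical NumberField
open WeierstrassCurve NumberField IsDedekindDomain Field CategoryTheory Function PowerSeries CongruenceSubgroup
open Literature.NumberTheory.EllipticCurves Literature.NumberTheory.EllipticCurves.Rank1Residual
open Literature.NumberTheory.EllipticCurves.ModularForms
open Literature.NumberTheory.EllipticCurves.Kato2004 Literature.NumberTheory.EllipticCurves.Kato2004.EulerSystemValues
open Literature.NumberTheory.GaloisRepresentations
open Literature.NumberTheory.EllipticCurves.IwasawaAlgebra₂ Literature.NumberTheory.EllipticCurves.UnrSeries₂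
open Literature.NumberTheory.EllipticCurves.GreenbergVatsal2000
open Literature.NumberTheory.EllipticCurves.BurungaleCastellaSkinner2025
open Literature.NumberTheory.EllipticCurves.YanZhu2026
open Summit.BirchSwinnertonDyer.BirchSwinnertonDyer.Theorems.TwoAdicKatoDeterminant

namespace Summit.BirchSwinnertonDyer.BirchSwinnertonDyer.Cruxes.OrdLambdaHalfAtTwo.KatoDeterminantGreenbergTwo

/-! ## §1 O2♭ at a datum `(W, K)` -/

/-- **O2♭ at `(E, K)` — the Greenberg-side lower inclusion at `2` UP TO POWERS OF `2`.**  Binder for binder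
`GreenbergLowerInclusionAt W K` (Defs p722332 §1) with two extra naturals `a b`: the Greenberg series `G ∈ 𝒪_{ℂ₂}⟦T₁,T₂⟧`
interpolates `2^a ·` (the Yan–Zhu Def. 3.11 values) — through the class-number slot `2^a · h_K` of
`IsGreenbergLFunctionFree₂` — and `2^b · ch_{Λ_K}(X_Gr(E/K̃_∞))·Λ_K^ur ⊆ (G)` along every structure-compatible `J`.
`λ`-equivalent to O2's body; strictly weaker integrally.  A `Prop`-valued function of `(W, K)`; nothing asserted.
[cite: YanZhu2024MainConjNonCM, Thm. 4.2 (2) first inclusion and Thm. 4.7 (1) (the S⁻¹-currency) (arXiv:2412.20078v4)]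
[cite: BurungaleCastellaSkinner2025, Conj. 4.1.2] -/
def GreenbergLowerInclusionRatAt (W : WeierstrassCurve ℚ) [W.IsElliptic] [W.IsGloballyMinimal]
    (K : Type) [Field K] [NumberField K] : Prop :=
  ∀ [IsCMField K] (ι : PadicAlgCl 2 ≃+* ℂ) (v vbar : HeightOneSpectrum (𝓞 K)) (κ₁ κ₂ : ZpExtension K 2)
    (γ₁ γ₂ : absoluteGaloisGroup K) [Fact (ZpExtension.IsTopGeneratorPair κ₁ κ₂ γ₁ γ₂)]
    [NeZero (W.conductorNorm ℤ)] (f : CuspForm (Gamma0 (W.conductorNorm ℤ)) 2),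
    ModularForms.IsNewformOf W f → ∀ [NeZero (NumberField.discr K).natAbs],
    ((2 : ℕ) : 𝓞 K) ∈ v.asIdeal → ((2 : ℕ) : 𝓞 K) ∈ vbar.asIdeal → vbar ≠ v →
    (∀ (w : InfinitePlace K) (k : 𝓞 K), k ∈ v.asIdeal ↔ ‖ι.symm (w.embedding (k : K))‖ < 1) →
    ∃ (a b : ℕ) (Ω δ : ℂ) (Ωp : (unrIntegers 2)ˣ) (LK G : PowerSeries (PowerSeries (PadicComplexInt 2))),
      Ω ≠ 0 ∧ (δ ^ 2 = (NumberField.discr K : ℂ) ∨ δ ^ 2 = -(NumberField.discr K : ℂ)) ∧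
      IsKatzMeasure₂ ι v vbar ∅ κ₁ κ₂ γ₁⁻¹ γ₂⁻¹ 1 Ω δ ((Ωp : unrIntegers 2) : ℂ_[2]) LK ∧
      IsGreenbergLFunctionFree₂ ι v vbar κ₁ κ₂ γ₁⁻¹ γ₂⁻¹ f (NumberField.discr K).natAbs
        (2 ^ a * NumberField.classNumber K) LK G ∧
      Module.IsTorsion (IwasawaAlgebra₂ 2) ((W.baseChange K).XGr₂ 2 κ₁ κ₂ vbar γ₁ γ₂) ∧
      ∀ J : ℤ_[2] →+* PadicComplexInt 2,
        (∀ x : ℤ_[2], ((J x : PadicComplexInt 2) : ℂ_[2]) = ((x : ℚ_[2]) : ℂ_[2])) →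
        Ideal.span {(2 : PowerSeries (PowerSeries (PadicComplexInt 2))) ^ b} *
            (WeierstrassCurve.XGr₂.charIdeal (W.baseChange K) 2 κ₁ κ₂ vbar γ₁ γ₂).map (toUnr₂ 2 J) ≤
          Ideal.span {G}

/-- **O2's body implies O2♭'s body** (`a = b = 0`). [folklore] -/
theorem greenbergLowerInclusionRatAt_of_inclusion {W : WeierstrassCurve ℚ} [W.IsElliptic] [W.IsGloballyMinimal]
    {K : Type} [Field K] [NumberField K] (h : GreenbergLowerInclusionAt W K) :
    GreenbergLowerInclusionRatAt W K := by
  intro _ ι v vbar κ₁ κ₂ γ₁ γ₂ _ _ f hf _ hv hvbar hne hι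
  obtain ⟨Ω, δ, Ωp, LK, G, hΩ, hδ, hLK, hG, htor, hincl⟩ := h ι v vbar κ₁ κ₂ γ₁ γ₂ f hf hv hvbar hne hι
  refine ⟨0, 0, Ω, δ, Ωp, LK, G, hΩ, hδ, hLK, by simpa using hG, htor, fun J hJ => ?_⟩
  rw [pow_zero, Ideal.span_singleton_one, Ideal.top_mul]
  exact hincl J hJ

/-! ## §2 The fallback binders O2♭ and O1♯ -/

/-- **O2♭ `BDPSelmerLowerDivisibilityAtTwoRat`** — the pre-declared restatement of item stmt-BirchSwinnertonDyer-24728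
should F-O2-int fire: on the habitat of 6‴ (`E/ℚ` non-CM, good ordinary at `2`, `E[2]` reducible, `K` imaginary
quadratic with the Heegner hypothesis for `2N`), `GreenbergLowerInclusionRatAt W K`.  Research grade, NOT in print at
`p = 2` (as O2).  A `Prop`; nothing asserted.
[cite: YanZhu2024MainConjNonCM, Thm. 4.2 (2), Thm. 4.7 (1)] [cite: BurungaleCastellaSkinner2025, Conj. 4.1.2] -/
@[conjecture] def BDPSelmerLowerDivisibilityAtTwoRat : Prop :=
  ∀ (W : WeierstrassCurve ℚ) [W.IsElliptic] [W.IsGloballyMinimal],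
    ¬ W.HasCM → GoodOrd W 2 → ¬ W.HasIrreducibleModPGaloisRep 2 →
    ∀ (K : Type) [Field K] [NumberField K],
      (IsImaginaryQuadratic K ∧ SatisfiesHeegnerHypothesis (2 * W.conductorNorm ℤ) K) →
      GreenbergLowerInclusionRatAt W K

/-- **O1♯ `SplitTwoExplicitReciprocityLawBDPRat`** — the pre-declared restatement of item stmt-BirchSwinnertonDyer-24727
paired with O2♭: `GreenbergLowerInclusionRatAt W K → ThetaDivisibilityAt W K` on the habitat (the split-`2`
ERL/transfer bridge fed with the `2`-power-slack inclusion; the constants are absorbed because the conclusion is a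
`λ`-inequality).  Implies O1 (`splitTwoExplicitReciprocityLawBDP_of_rat`).  Research grade; a `Prop`; nothing asserted.
[cite: YanZhu2024MainConjNonCM, Thm. 4.7] [cite: BurungaleCastellaSkinner2025, Thm. 4.1.3]
[cite: BurungaleSkinnerTianWan2024, §9.3.2, Prop. 9.18] -/
@[conjecture] def SplitTwoExplicitReciprocityLawBDPRat : Prop :=
  ∀ (W : WeierstrassCurve ℚ) [W.IsElliptic] [W.IsGloballyMinimal],
    ¬ W.HasCM → GoodOrd W 2 → ¬ W.HasIrreducibleModPGaloisRep 2 →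
    ∀ (K : Type) [Field K] [NumberField K],
      (IsImaginaryQuadratic K ∧ SatisfiesHeegnerHypothesis (2 * W.conductorNorm ℤ) K) →
      GreenbergLowerInclusionRatAt W K → ThetaDivisibilityAt W K

/-! ## §3 Kernel links -/

/-- O2 ⟹ O2♭. [folklore] -/
theorem bdpSelmerLowerDivisibilityAtTwoRat_of_bdp (h : BDPSelmerLowerDivisibilityAtTwo) :
    BDPSelmerLowerDivisibilityAtTwoRat :=
  fun W _ _ hCM hGO hβ K _ _ hK => greenbergLowerInclusionRatAt_of_inclusion (h W hCM hGO hβ K hK)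

/-- O1♯ ⟹ O1. [folklore] -/
theorem splitTwoExplicitReciprocityLawBDP_of_rat (h : SplitTwoExplicitReciprocityLawBDPRat) :
    SplitTwoExplicitReciprocityLawBDP :=
  fun W _ _ hCM hGO hβ K _ _ hK hGr => h W hCM hGO hβ K hK (greenbergLowerInclusionRatAt_of_inclusion hGr)

/-- **The fallback seam: O1♯ and O2♭ give 6‴** (binder shuffling, as `thetaShapiroGreenbergDivisibilityAtTwo_of_bdp`).  So
a re-registration of the skeleton with {O2♭, O1♯} in place of {O2, O1} leaves `OrdLambdaHalfAtTwo_of` untouched.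
[folklore] -/
theorem thetaShapiroGreenbergDivisibilityAtTwo_of_bdpRat (h₁ : SplitTwoExplicitReciprocityLawBDPRat)
    (h₂ : BDPSelmerLowerDivisibilityAtTwoRat) : ThetaShapiroGreenbergDivisibilityAtTwo := by
  intro W _ _ hCM hGO hβ κ γ hκ hγ hγ' hord _ f hf D L₀ hL₀ K _ _ hK
  exact h₁ W hCM hGO hβ K hK (h₂ W hCM hGO hβ K hK) κ γ hκ hγ hγ' hord f hf D L₀ hL₀

/-- 6‴ ⟹ O1♯ (O1♯ is still WEAKER than 6‴: an implication with 6‴'s body as conclusion). [folklore] -/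
theorem splitTwoExplicitReciprocityLawBDPRat_of_theta (h : ThetaShapiroGreenbergDivisibilityAtTwo) :
    SplitTwoExplicitReciprocityLawBDPRat := by
  intro W _ _ hCM hGO hβ K _ _ hK _ κ γ hκ hγ hγ' hord _ f hf D L₀ hL₀
  exact h W hCM hGO hβ κ γ hκ hγ hγ' hord f hf D L₀ hL₀ K hK

end Summit.BirchSwinnertonDyer.BirchSwinnertonDyer.Cruxes.OrdLambdaHalfAtTwo.KatoDeterminantGreenbergTwo

end
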